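import Summits.ValiantsHypothesis.ValiantsHypothesis.Theorems.KPlusLogSqLawTropicalBColumnFanout
import Summits.ValiantsHypothesis.ValiantsHypothesis.Theorems.KPlusLogSqLawTropicalBOneCutLift
import Summits.ValiantsHypothesis.ValiantsHypothesis.Theorems.KPlusLogSqLawTropicalBSignsFree

/-!
# Route `KPlusLogSqLaw`, crux `TropicalB` (stmt-ValiantsHypothesis-19771) — TERNARY MENUS ARE UNIVERSAL: the crux restricted to menu designs
# in which EVERY column offers at most three rows

HONEST FRAMING.  Helper file (seat val-sym-trop-p1 g16, cell `pub-symmetroid`, 2026-08-28) toward the registered stubs `stub_tropThin` /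
`stub_tropFat` of `Cruxes/TropicalB/Lines/birth.lean` (crux `Summit.ValiantsHypothesis.ValiantsHypothesis.Theses.KPlusLogSqLaw.TropicalB`,
item `stmt-ValiantsHypothesis-19771`, route `KPlusLogSqLaw`; `--supports … --as helper`).  COMPOSITION of two normal forms of the tree — the
column fan-out `ColumnFanout.tropRowD_of_degreeThree` (p594963: three present rows per column are universal, format `(m(m+1), K+1)`) and the
menu lift `OneCut.exists_menu_lift` (this seat: slope and valuation on a strip of private menus, weightless complement of column-degree `2`,
degree control).  It bounds nothing for `TropicalB` and bears on neither `WeakLifting`, the doors, `MatrixDescartes` (stmt-ValiantsHypothesis-18050)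
nor VP ≠ VNP.

THE CLASS.  A TERNARY MENU design of width `w` and format `(M, K')`: (1) columns of index `≥ w` carry only classes of exponent `0`, (2) and only
valuation `0`, (3) every row is available to at most one column of index `< w`, (5) EVERY column has at most three present rows (so (4) of
`…TropicalBOneCut` holds a fortiori up to `3`).  A term is then a vector of at most TERNARY choices, one per column, the strip choices carrying all
slope and valuation additively, coupled only through «every row is used exactly once».

* `tropRowD_of_ternaryMenus` — if every ternary menu design of width `m(m+1)` and format `((m(m+1)+1)·m(m+1), K+2)` has unsigned row bound `B`,
  then `TropRowD m K B` (proof: fan out the columns to degree `3`, then lift to menus; the lift keeps strip degrees and adds degree-`2` columns);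
* `tropicalB_of_ternaryMenus` — hence ONE constant for all ternary menu designs (bound `2^(C·(K+1+⌊log₂ m⌋²))` at the format built from `(m, K)`)
  gives `TropicalB`; `ternaryMenus_of_tropicalB` — the converse specialisation (bound written at the big format, no logarithm cosmetics).

So `TropicalB` is equivalent to a statement about chains of uniquely completable vectors of TERNARY choices with separable slopes and values
(binary choices everywhere are linear: `…TropicalBTwoRowsPerColumn`).  [folklore] (composition of gadgets)
-/

set_option linter.dupNamespace false
set_option autoImplicit false

namespace Summit.ValiantsHypothesis.ValiantsHypothesis.Theorems.KPlusLogSqLaw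

open Summit.ValiantsHypothesis.ValiantsHypothesis.Theorems.MatrixDescartes.Negative
open Summit.ValiantsHypothesis.ValiantsHypothesis.Theorems.LacunarySymmetroidMatrixDescartes
open Summit.ValiantsHypothesis.ValiantsHypothesis.Theses.KPlusLogSqLaw (TropicalB)
open scoped BigOperators
open Finset
namespace OneCut

/-- **TERNARY MENUS ARE UNIVERSAL.**  If every design of format `((m(m+1)+1)·m(m+1), K+2)` in which (1) the columns of index `≥ m(m+1)` carry only
exponent-`0` classes and (2) only zero valuations, (3) every row is available to at most one column of index `< m(m+1)`, and (5) every column has at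
most three present rows, satisfies the unsigned row bound `B`, then every design of format `(m, K)` does. [folklore] -/
theorem tropRowD_of_ternaryMenus (m K B : ℕ)
    (h : ∀ (d' : Fin (K + 1 + 1) → ℕ)
      (v' ε' : Fin ((m * (m + 1) + 1) * (m * (m + 1))) → Fin ((m * (m + 1) + 1) * (m * (m + 1))) → Fin (K + 1 + 1) → ℤ),
      (∀ (a b : Fin ((m * (m + 1) + 1) * (m * (m + 1)))) (l : Fin (K + 1 + 1)), m * (m + 1) ≤ (b : ℕ) → ε' a b l ≠ 0 → d' l = 0) →
      (∀ (a b : Fin ((m * (m + 1) + 1) * (m * (m + 1)))) (l : Fin (K + 1 + 1)), m * (m + 1) ≤ (b : ℕ) → v' a b l = 0) →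
      (∀ (a b b' : Fin ((m * (m + 1) + 1) * (m * (m + 1)))) (l l' : Fin (K + 1 + 1)), (b : ℕ) < m * (m + 1) → (b' : ℕ) < m * (m + 1) →
        ε' a b l ≠ 0 → ε' a b' l' ≠ 0 → b = b') →
      (∀ b : Fin ((m * (m + 1) + 1) * (m * (m + 1))), (Finset.univ.filter fun a => ∃ l, ε' a b l ≠ 0).card ≤ 3) →
      DesignRowD d' v' ε' B) :
    TropRowD m K B := by
  classical
  refine ColumnFanout.tropRowD_of_degreeThree m K B (fun d₁ v₁ ε₁ hdeg₁ => ?_)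
  obtain ⟨d', v', ε', h1, h2, h3, h4, h5, htr⟩ := exists_menu_lift (m * (m + 1)) (K + 1) d₁ v₁ ε₁
  refine htr B (h d' v' ε' h1 h2 h3 ?_)
  intro b
  by_cases hb : (b : ℕ) < m * (m + 1)
  · exact (h5 b hb).trans (hdeg₁ ⟨b, hb⟩)
  · exact (h4 b (not_lt.mp hb)).trans (by norm_num)

/-- **One constant for all ternary menu designs gives `TropicalB`** (bound written at the format `(m, K)` the design simulates). [folklore] -/
theorem tropicalB_of_ternaryMenus
    (h : ∃ C : ℕ, ∀ (m K : ℕ) (d' : Fin (K + 1 + 1) → ℕ)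
      (v' ε' : Fin ((m * (m + 1) + 1) * (m * (m + 1))) → Fin ((m * (m + 1) + 1) * (m * (m + 1))) → Fin (K + 1 + 1) → ℤ),
      (∀ (a b : Fin ((m * (m + 1) + 1) * (m * (m + 1)))) (l : Fin (K + 1 + 1)), m * (m + 1) ≤ (b : ℕ) → ε' a b l ≠ 0 → d' l = 0) →
      (∀ (a b : Fin ((m * (m + 1) + 1) * (m * (m + 1)))) (l : Fin (K + 1 + 1)), m * (m + 1) ≤ (b : ℕ) → v' a b l = 0) →
      (∀ (a b b' : Fin ((m * (m + 1) + 1) * (m * (m + 1)))) (l l' : Fin (K + 1 + 1)), (b : ℕ) < m * (m + 1) → (b' : ℕ) < m * (m + 1) →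
        ε' a b l ≠ 0 → ε' a b' l' ≠ 0 → b = b') →
      (∀ b : Fin ((m * (m + 1) + 1) * (m * (m + 1))), (Finset.univ.filter fun a => ∃ l, ε' a b l ≠ 0).card ≤ 3) →
      DesignRowD d' v' ε' (2 ^ (C * (K + 1 + Nat.log 2 m ^ 2)))) :
    TropicalB := by
  obtain ⟨C, hC⟩ := h
  refine tropicalB_iff_unsigned.mpr ⟨2 * C, fun m K => ?_⟩
  rcases Nat.eq_zero_or_pos K with rfl | hK
  · exact tropRowD_zero m _
  · refine tropRowD_mono (Nat.pow_le_pow_right (by norm_num) ?_)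
      (tropRowD_of_ternaryMenus m K _ (fun d' v' ε' h1 h2 h3 h5 => hC m K d' v' ε' h1 h2 h3 h5))
    nlinarith

/-- **Converse specialisation**: `TropicalB` bounds the ternary menu designs too (they are designs; bound written at their own format). [folklore] -/
theorem ternaryMenus_of_tropicalB (hTB : TropicalB) :
    ∃ C : ℕ, ∀ (m K : ℕ) (d' : Fin (K + 1 + 1) → ℕ)
      (v' ε' : Fin ((m * (m + 1) + 1) * (m * (m + 1))) → Fin ((m * (m + 1) + 1) * (m * (m + 1))) → Fin (K + 1 + 1) → ℤ),
      DesignRowD d' v' ε' (2 ^ (C * (K + 1 + 1 + Nat.log 2 ((m * (m + 1) + 1) * (m * (m + 1))) ^ 2))) := by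
  obtain ⟨C, hC⟩ := tropicalB_iff_unsigned.mp hTB
  exact ⟨C, fun m K d' v' ε' => hC _ _ d' v' ε'⟩

end OneCut

end Summit.ValiantsHypothesis.ValiantsHypothesis.Theorems.KPlusLogSqLaw
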